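import Summits.Ventures.HSemireg.HomComplex
import Summits.Ventures.HSemireg.ContractDinatural
import Summits.Ventures.HSemireg.HigherSigmaOfIso
import Literature.AlgebraicGeometry.HodgeTheory.AtiyahClassTraceNaturality
import HarnessLib

/-!
# The supertrace `𝓗om•(E•, E• ⊗ G) ⟶ G[0]` of a cochain complex with finite locally free terms

Cell `pub-hsemireg`, Lean side (p3); K2-MIN piece (h), p3 half (split with t-7 g5, bus 11:07:23Z: t-7 = unit +
assembly of `σ_q`). HONEST FRAMING: kernel plumbing on the cell's real carriers (`HomComplex.lean`, t-7: the internal Hom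
complex with Mathlib's Hom-complex sign convention; `ContractDinatural.lean`: trace cyclicity); NOT a door, NOT a fact,
NOT a «K2 result», nothing about any variety.

For a scheme `X`, an `𝒪_X`-module `G`, a cochain complex `E•` with `hE : ∀ n, IsFiniteLocallyFree (E.X n)`:
`twistG X G E• = E• ⊗ G` (gs-g4's `twistFunctor X G` termwise); `strComp` — the component `(-1)^i • str_{E^{-i}}` on
the summand `(q, i)`, `q + i = 0`, of `𝓗om•(E•, E• ⊗ G)^0 = ∐_p 𝓗om(E^p, E^p ⊗ G)`; `str₀ = Σ_p (-1)^p str_{E^p}`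
(`HomologicalComplex.mapBifunctorDesc`); `strComp_cancel` + `d_str₀ : d^{-1} ≫ str₀ = 0` — on the summand `(q, i)` of
degree `-1` the `d_{E⊗G}`-term (through `(q+1, i)`, `ι_D₁`) and the `d_E`-term (through `(q, i+1)`, `ι_D₂`, sign
`((−1)+1).negOnePow = 1`) cancel by `contract_dinatural` and `(-1)^i + (-1)^{i+1} = 0`; and
**`supertrace X G E hE : homComplex X E (twistG X G E) ⟶ G[0]`** (`HomologicalComplex.mkHomToSingle`), and its
naturality in `G` (`supertrace_naturality`: `𝓗om•(E•, E• ⊗ g) ≫ Tr•_{G'} = Tr•_G ≫ g[0]`, from the tree's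
`sheafHomMap_sheafHomMap_comp_contract`). No boundedness is needed for `Tr•` (it is needed for the unit, t-7's
`HomComplex.unit`).

## References

* R.-O. Buchweitz, H. Flenner, Compositio Math. 137 (2003), §4 (trace maps `Ext^i(F, F ⊗ G) → H^i(X, G)`). [BuchweitzFlenner2003]
-/

noncomputable section

open CategoryTheory CategoryTheory.Limits AlgebraicGeometry Opposite

namespace Summit.Ventures.HSemireg

open Literature.AlgebraicGeometry.Modules Literature.AlgebraicGeometry.Motives
  Summit.HodgeConjecture.HodgeConjecture.Theorems.PadicPridhamSemiregularity

namespace HomComplex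

section Supertrace

universe w

variable (X : Scheme.{w}) (G : X.Modules) (E : CochainComplex X.Modules ℤ)
  (hE : ∀ n, IsFiniteLocallyFree (E.X n)) (a b : ℤ)

/-- `E• ⊗ G`: the twist functor `F ↦ 𝓗om(F^∨, G)` (HigherSigmaOfIso `twistFunctor`) applied termwise. -/
abbrev twistG : CochainComplex X.Modules ℤ :=
  ((twistFunctor X G).mapHomologicalComplex (ComplexShape.up ℤ)).obj E

/-- The supertrace component on the summand `(q, i)` of total degree `0` of `𝓗om•(E•, E• ⊗ G)`:
`(-1)^i • str_{E^{-i}}` (transported along `q = -i`). [folklore] -/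
def strComp (q i : ℤ) (h : q + i = 0) : sheafHom (E.X (-i)) ((twistG X G E).X q) ⟶ G :=
  (i.negOnePow : ℤˣ) • (sheafHomMap (E.X (-i)) ((twistG X G E).XIsoOfEq (show q = -i by omega)).hom ≫
    contract (hE (-i)) G)

/-- The degree-`0` supertrace `𝓗om•(E•, E• ⊗ G)^0 = ∐_p 𝓗om(E^p, E^p ⊗ G) ⟶ G`, `Σ_p (-1)^p str_{E^p}`. [folklore] -/
def str₀ : (homComplex X E (twistG X G E)).X 0 ⟶ G :=
  HomologicalComplex.mapBifunctorDesc (strComp X G E hE)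

/-- On the summand `(q, i)`, `str₀` is `strComp q i`. [folklore] -/
lemma ι_str₀ (q i : ℤ) (h : q + i = 0) : ι X E (twistG X G E) q i 0 h ≫ str₀ X G E hE = strComp X G E hE q i h :=
  HomologicalComplex.ι_mapBifunctorDesc _ _ _ _

/-- The cancellation behind the chain-map property: on the summand `(q₀, i)` of degree `-1`, the
`d_{E⊗G}`-term through `(q₁, i)` and the `d_E`-term through `(q₀, i + 1)` cancel — trace cyclicity
(`contract_dinatural`) and `(-1)^i + (-1)^{i+1} = 0`. [folklore] -/
lemma strComp_cancel (i q₀ q₁ : ℤ) (e₀ : q₀ = -(i + 1)) (e₁ : q₁ = -i) (h₀ : q₀ + (i + 1) = 0)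
    (h₁ : q₁ + i = 0) :
    sheafHomMap (E.X (-i)) ((twistG X G E).d q₀ q₁) ≫ strComp X G E hE q₁ i h₁ +
      sheafHomMapLeft (E.d (-(i + 1)) (-i)) ((twistG X G E).X q₀) ≫ strComp X G E hE q₀ (i + 1) h₀ = 0 := by
  subst e₀ e₁
  simp only [strComp, HomologicalComplex.XIsoOfEq_rfl, Iso.refl_hom, sheafHomMap_id, Category.id_comp,
    Linear.comp_units_smul, Functor.mapHomologicalComplex_obj_d, twistFunctor_map]
  erw [contract_dinatural G (hE (-(i + 1))) (hE (-i)) (E.d (-(i + 1)) (-i))]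
  rw [Int.negOnePow_succ, Units.neg_smul]
  exact add_neg_cancel _

/-- **The degree-`0` supertrace kills boundaries**: `d^{-1} ≫ str₀ = 0`. [folklore] -/
theorem d_str₀ : (homComplex X E (twistG X G E)).d (-1) 0 ≫ str₀ X G E hE = 0 := by
  refine HomologicalComplex.mapBifunctor.hom_ext fun q i (h : q + i = -1) => ?_
  rw [comp_zero, HomologicalComplex.mapBifunctor.d_eq, Preadditive.add_comp, Preadditive.comp_add]
  have e : ((-1 : ℤ) + 1).negOnePow = 1 := by
    rw [show (-1 : ℤ) + 1 = 0 by norm_num, Int.negOnePow_zero]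
  have h₁ : ι X E (twistG X G E) q i (-1) h ≫
      HomologicalComplex.mapBifunctor.D₁ (twistG X G E) (dualComplex X E) (sheafHomBifunctor X).flip
        (ComplexShape.up ℤ) (-1) 0 ≫ str₀ X G E hE =
      sheafHomMap (E.X (-i)) ((twistG X G E).d q (q + 1)) ≫ strComp X G E hE (q + 1) i (by omega) := by
    rw [← Category.assoc, ι_D₁ X E (twistG X G E) q i (-1) 0 h (by omega), Category.assoc, ι_str₀]
  have h₂ : ι X E (twistG X G E) q i (-1) h ≫
      HomologicalComplex.mapBifunctor.D₂ (twistG X G E) (dualComplex X E) (sheafHomBifunctor X).flip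
        (ComplexShape.up ℤ) (-1) 0 ≫ str₀ X G E hE =
      sheafHomMapLeft (E.d (-(i + 1)) (-i)) ((twistG X G E).X q) ≫ strComp X G E hE q (i + 1) (by omega) := by
    rw [← Category.assoc, ι_D₂ X E (twistG X G E) q i (-1) 0 h (by omega), e, one_smul, Category.assoc, ι_str₀]
  exact (congrArg₂ (· + ·) h₁ h₂).trans (strComp_cancel X G E hE i q (q + 1) (by omega) (by omega) _ _)

/-- **The supertrace** `Tr• : 𝓗om•(E•, E• ⊗ G) ⟶ G[0]` (`Σ_p (-1)^p str_{E^p}` in degree `0`), a chain map for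
any complex `E•` with finite locally free terms (boundedness is only needed for the unit).
[cite: BuchweitzFlenner2003, §4 (trace map)] -/
def supertrace : homComplex X E (twistG X G E) ⟶ (HomologicalComplex.single X.Modules (ComplexShape.up ℤ) 0).obj G :=
  HomologicalComplex.mkHomToSingle (str₀ X G E hE) fun j hj => by
    obtain rfl : j = -1 := by simp at hj; omega
    exact d_str₀ X G E hE

end Supertrace


/-! ### Naturality of the supertrace in the coefficient module `G` -/

section SupertraceNaturality

universe w

variable (X : Scheme.{w}) {G G' : X.Modules} (E : CochainComplex X.Modules ℤ)
  (hE : ∀ n, IsFiniteLocallyFree (E.X n))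

/-- `F ⊗ G → F ⊗ G'` induced by `g : G → G'`, natural in `F` (exchange law). [folklore] -/
@[simps]
def twistCoeffNatTrans (g : G ⟶ G') : twistFunctor X G ⟶ twistFunctor X G' where
  app F := sheafHomMap (dual F) g
  naturality _ _ _ := sheafHomMapLeft_sheafHomMap _ _ _

/-- `E• ⊗ G → E• ⊗ G'` termwise. [folklore] -/
abbrev twistGMap (g : G ⟶ G') : twistG X G E ⟶ twistG X G' E :=
  (NatTrans.mapHomologicalComplex (twistCoeffNatTrans X g) (ComplexShape.up ℤ)).app E

/-- On summands: the supertrace components are natural in `G` (the tree's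
`sheafHomMap_sheafHomMap_comp_contract`). [folklore] -/
lemma strComp_naturality (g : G ⟶ G') (q i : ℤ) (h : q + i = 0) :
    sheafHomMap (E.X (-i)) ((twistGMap X E g).f q) ≫ strComp X G' E hE q i h = strComp X G E hE q i h ≫ g := by
  obtain rfl : q = -i := by omega
  simp only [strComp, HomologicalComplex.XIsoOfEq_rfl, Iso.refl_hom, sheafHomMap_id, Category.id_comp,
    NatTrans.mapHomologicalComplex_app_f, twistCoeffNatTrans_app]
  rw [Linear.comp_units_smul, Linear.units_smul_comp]
  congr 1
  exact Literature.AlgebraicGeometry.HodgeTheory.sheafHomMap_sheafHomMap_comp_contract (hE (-i)) g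

/-- In degree `0`: `𝓗om•(E•, g) ≫ str₀' = str₀ ≫ g`. [folklore] -/
lemma map_str₀ (g : G ⟶ G') :
    (map X E (twistGMap X E g)).f 0 ≫ str₀ X G' E hE = str₀ X G E hE ≫ g := by
  refine HomologicalComplex.mapBifunctor.hom_ext fun q i (h : q + i = 0) => ?_
  change ι X E (twistG X G E) q i 0 h ≫ _ = ι X E (twistG X G E) q i 0 h ≫ _
  rw [reassoc_of% (ι_map X E (twistGMap X E g) q i 0 h), ι_str₀ X G' E hE q i h,
    reassoc_of% (ι_str₀ X G E hE q i h)]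
  exact strComp_naturality X E hE g q i h

/-- **The supertrace is natural in the coefficients**: `𝓗om•(E•, E• ⊗ g) ≫ Tr•_{G'} = Tr•_G ≫ g[0]`.
[cite: BuchweitzFlenner2003, §4 (trace map)] -/
theorem supertrace_naturality (g : G ⟶ G') :
    map X E (twistGMap X E g) ≫ supertrace X G' E hE =
      supertrace X G E hE ≫ (HomologicalComplex.single X.Modules (ComplexShape.up ℤ) 0).map g :=
  HomologicalComplex.to_single_hom_ext (by
    simp only [supertrace, HomologicalComplex.comp_f, HomologicalComplex.mkHomToSingle_f,
      HomologicalComplex.single_map_f_self, Category.assoc, Iso.inv_hom_id_assoc]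
    rw [← Category.assoc, map_str₀, Category.assoc])

end SupertraceNaturality




end HomComplex

end Summit.Ventures.HSemireg

end
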